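import Summits.ResolutionOfSingularities.ResolutionOfSingularities.Theorems.DeltaCutSepCertificates
import HarnessLib

/-!
# DeltaCutSepCertificates2 — decomp-res node «SepCut» (lens-6 g26, critic row 196 CLEARED +1), tree file 5/8 of the node

Content VERBATIM from the decomp-res lens-6 g26 node `HOME/decomp-res-lens-6/g26/SepCut.lean` (pin f15f025c; no
carry, imports the landed tree only); HOME = run/shared/lean/pub/decomp-res; critic row 196 CLEARED +1; landing plan
NEXT-g27.md fb3fac1c §4 + rider INBOX :1178 — provenance, critic text and the lens header in full in the first file
of the node, `DeltaCutSep`.  Namespace `…Theorems.DeltaCutClasses`; `--supports stmt-ResolutionOfSingularities-26971`.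

## This file

Continuation 2/5 of `DeltaCutSepCertificates` (same section of the node, cut at the 400-line cap): carries
`Pinf_chart_u_only`, `Pinf_chart_z_noTop`, `Pinf_symm`, `linChartSubst`, `Pinf_L1_lineChart_X2`,
`Pinf_L1_lineChart_X3`, `Pinf_L1_lineChart_X0`, `Pinf_L1_lineChart_X2_noTop`, `Pinf_L1_lineChart_X3_tame`,
`Pinf_L1_lineChart_X0_noTop`, `Pinf_perpetual_certificate`, `Pinf_sepHeightOne_certificate`, `Pinf_near`.

[WRITER NOTE (decomp-res writer g12): file split only (tree files ≤ 400 lines); namespace, sections, section opens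
and every declaration exactly as in the lens (the node's HOME-only dupNamespace-linter line is dropped; the two
namespace-level `open …TwistCutClasses` / `open …LightCutClasses` lines of the node are replayed); in the
CERTIFICATES files the lens's five `private` helpers (`mem_of_sMul_mem_cube`, `mul_mem_pow_add`,
`not_mem_span_of_eval`, `sMul_not_mem_sq_of_pderiv_eq_one`, and `one_not_mem_prime`) lose `private` because their
users now sit in later parts of the split, and `one_not_mem_prime` — statement-identical to the LANDED
`one_not_mem_of_isPrime` of g25 `DeltaCutRunCertificates` (a `dedup.landed` restatement) — is DELETED and its 12
uses cite `one_not_mem_of_isPrime` (hence the extra import `DeltaCutRunCertificates`); likewise `mul_mem_pow_add` —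
statement-identical to the LANDED `Rescue.BedZpeBinom4Centre.mul_mem_pow_add` of another hand (cone-free module;
pre-flight `dedup.landed`) — is DELETED, that module imported and `open … (mul_mem_pow_add)` replayed in each
certificates file so the 6 uses stand verbatim.]

(Sources: Hironaka1967 (characteristic polyhedra); CossartJannsenSaito2020 Def. 3.13 / Thm. 3.14, Ch. 8, Thm. 9.6;
Hironaka1970 (near points / vertices); CossartPiltant2019 Prop. 2.6; CossartPiltant2008 §2; Giraud1975; Hironaka2005
(three key theorems: order under permissible blow-up); EGAIV4 §16–§17; StacksProject 0804 / 0BIQ / 031I; Matsumura1987 §28.)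
-/

noncomputable section

open CategoryTheory CategoryTheory.Limits AlgebraicGeometry TopologicalSpace IsLocalRing
open Literature.AlgebraicGeometry.Resolution

universe u

open Summit.ResolutionOfSingularities.ResolutionOfSingularities.Theorems.Rescue.BedZpeBinom4Centre (mul_mem_pow_add)

namespace Summit.ResolutionOfSingularities.ResolutionOfSingularities.Theorems.DeltaCutClasses

open Summit.ResolutionOfSingularities.ResolutionOfSingularities.Theorems.TwistCutClasses
open Summit.ResolutionOfSingularities.ResolutionOfSingularities.Theorems.LightCutClasses

section SepCertificates

open MvPolynomial
variable {K : Type*} [Field K]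

/-- **P∞, chart `u` — the ONLY top point is the chart origin, and it is TAME**: a prime of order `≥ 3` for `z'³ +
u·s'·w'` contains all
four coordinates (`∂_{s'}`, then `∂_{w'}` / `∂_u`; `∂_{w'}` then `∂_u`), and `∂_{s'}∂_{w'} = u` is a regular
parameter at the origin.
[new; elementary] [folklore] -/
theorem Pinf_chart_u_only (𝔮 : Ideal (MvPolynomial (Fin 4) K)) [𝔮.IsPrime] {s : MvPolynomial (Fin 4) K} (hs : s ∉ 𝔮)
    (h : s * (X 0 ^ 3 + X 1 * X 2 * X 3 : MvPolynomial (Fin 4) K) ∈ 𝔮 ^ 3) :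
    ((X 0 : MvPolynomial (Fin 4) K) ∈ 𝔮 ∧ (X 1 : MvPolynomial (Fin 4) K) ∈ 𝔮 ∧ (X 2 : MvPolynomial (Fin 4) K) ∈ 𝔮 ∧
      (X 3 : MvPolynomial (Fin 4) K) ∈ 𝔮) ∧
      (pderiv 1) ((pderiv 3) (X 0 ^ 3 + X 1 * X 2 * X 3 : MvPolynomial (Fin 4) K)) = X 2 ∧
      ∀ s' ∉ Ideal.span {(X 0 : MvPolynomial (Fin 4) K), X 1, X 2, X 3},
        s' * (X 2 : MvPolynomial (Fin 4) K) ∉ (Ideal.span {(X 0 : MvPolynomial (Fin 4) K), X 1, X 2, X 3}) ^ 2 := by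
  have hs2 : s ^ 2 ∉ 𝔮 := pow_not_mem 𝔮 hs 2
  have hs4 : (s ^ 2) ^ 2 ∉ 𝔮 := pow_not_mem 𝔮 hs2 2
  have h1n := one_not_mem_of_isPrime 𝔮
  have e10 := f_ne K (i := 1) (j := 0) (by decide)
  have e12 := f_ne K (i := 1) (j := 2) (by decide)
  have e13 := f_ne K (i := 1) (j := 3) (by decide)
  have e20 := f_ne K (i := 2) (j := 0) (by decide)
  have e21 := f_ne K (i := 2) (j := 1) (by decide)
  have e23 := f_ne K (i := 2) (j := 3) (by decide)
  have e30 := f_ne K (i := 3) (j := 0) (by decide)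
  have e31 := f_ne K (i := 3) (j := 1) (by decide)
  have e32 := f_ne K (i := 3) (j := 2) (by decide)
  have e11 := f_self K 1
  have e22 := f_self K 2
  have e33 := f_self K 3
  have d1 : pderiv 1 (X 0 ^ 3 + X 1 * X 2 * X 3 : MvPolynomial (Fin 4) K) = X 2 * X 3 := by
    simp only [map_add, Derivation.leibniz, Derivation.leibniz_pow, smul_eq_mul, nsmul_eq_mul, e10, e11, e12, e13]
    push_cast; ring
  have d13 : pderiv 3 (X 2 * X 3 : MvPolynomial (Fin 4) K) = 1 * X 2 ^ 1 := by
    simp only [Derivation.leibniz, smul_eq_mul, e32, e33]; ring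
  have d12 : pderiv 2 (X 2 * X 3 : MvPolynomial (Fin 4) K) = 1 * X 3 ^ 1 := by
    simp only [Derivation.leibniz, smul_eq_mul, e22, e23]; ring
  have d3 : pderiv 3 (X 0 ^ 3 + X 1 * X 2 * X 3 : MvPolynomial (Fin 4) K) = X 1 * X 2 := by
    simp only [map_add, Derivation.leibniz, Derivation.leibniz_pow, smul_eq_mul, nsmul_eq_mul, e30, e31, e32, e33]
    push_cast; ring
  have d32 : pderiv 2 (X 1 * X 2 : MvPolynomial (Fin 4) K) = 1 * X 1 ^ 1 := by
    simp only [Derivation.leibniz, smul_eq_mul, e21, e22]; ring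
  have h1 := sq_mul_deriv_mem_pow 𝔮 h (pderiv 1)
  rw [d1] at h1
  have hX2 : (X 2 : MvPolynomial (Fin 4) K) ∈ 𝔮 := by
    have h' := sq_mul_deriv_mem_pow 𝔮 h1 (pderiv 3)
    rw [d13] at h'
    exact mem_of_mul_mul_pow_mem_pow 𝔮 one_ne_zero hs4 h1n h'
  have hX3 : (X 3 : MvPolynomial (Fin 4) K) ∈ 𝔮 := by
    have h' := sq_mul_deriv_mem_pow 𝔮 h1 (pderiv 2)
    rw [d12] at h'
    exact mem_of_mul_mul_pow_mem_pow 𝔮 one_ne_zero hs4 h1n h'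
  have hX1 : (X 1 : MvPolynomial (Fin 4) K) ∈ 𝔮 := by
    have h3 := sq_mul_deriv_mem_pow 𝔮 h (pderiv 3)
    rw [d3] at h3
    have h' := sq_mul_deriv_mem_pow 𝔮 h3 (pderiv 2)
    rw [d32] at h'
    exact mem_of_mul_mul_pow_mem_pow 𝔮 one_ne_zero hs4 h1n h'
  have hf : (X 0 ^ 3 + X 1 * X 2 * X 3 : MvPolynomial (Fin 4) K) ∈ 𝔮 := mem_of_sMul_mem_cube 𝔮 hs h
  have hX0 : (X 0 : MvPolynomial (Fin 4) K) ∈ 𝔮 := by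
    refine ‹𝔮.IsPrime›.mem_of_pow_mem 3 ?_
    have := Ideal.sub_mem _ hf (Ideal.mul_mem_right (X 3) _ (Ideal.mul_mem_right (X 2) _ hX1))
    rwa [add_sub_cancel_right] at this
  have dd : (pderiv 1) ((pderiv 3) (X 0 ^ 3 + X 1 * X 2 * X 3 : MvPolynomial (Fin 4) K)) = X 2 := by
    rw [d3]; simp only [Derivation.leibniz, smul_eq_mul, e11, e12]; ring
  refine ⟨⟨hX0, hX1, hX2, hX3⟩, dd, fun s' hs' hmem => ?_⟩
  exact sMul_not_mem_sq_of_pderiv_eq_one _ 2 (X_mem_spanX4 2) (f_self K 2) hs' hmem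

/-- **P∞, chart `z` — NO top point**: `1 + z·s'·u'²·w'` has no prime of order `≥ 3` (indeed `≥ 2`: `∂_{s'}` gives
`z·u'²·w' ∈ 𝔮`, and
then `1 ∈ 𝔮`). [new; elementary] [folklore] -/
theorem Pinf_chart_z_noTop (𝔮 : Ideal (MvPolynomial (Fin 4) K)) [𝔮.IsPrime] {s : MvPolynomial (Fin 4) K} (hs : s ∉ 𝔮)
    (h : s * (1 + X 0 * X 1 * X 2 ^ 2 * X 3 : MvPolynomial (Fin 4) K) ∈ 𝔮 ^ 3) : False := by
  have hs2 : s ^ 2 ∉ 𝔮 := pow_not_mem 𝔮 hs 2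
  have e10 := f_ne K (i := 1) (j := 0) (by decide)
  have e12 := f_ne K (i := 1) (j := 2) (by decide)
  have e13 := f_ne K (i := 1) (j := 3) (by decide)
  have e11 := f_self K 1
  have d1 : pderiv 1 (1 + X 0 * X 1 * X 2 ^ 2 * X 3 : MvPolynomial (Fin 4) K) = X 0 * X 2 ^ 2 * X 3 := by
    simp only [map_add, Derivation.leibniz, Derivation.leibniz_pow, smul_eq_mul, nsmul_eq_mul, e10, e11, e12, e13, f_one]
    push_cast; ring
  have h1 := sq_mul_deriv_mem_pow 𝔮 h (pderiv 1)
  rw [d1] at h1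
  have hm : (X 0 * X 2 ^ 2 * X 3 : MvPolynomial (Fin 4) K) ∈ 𝔮 :=
    (‹𝔮.IsPrime›.mem_or_mem (Ideal.pow_le_self two_ne_zero h1)).resolve_left hs2
  have hf : (1 + X 0 * X 1 * X 2 ^ 2 * X 3 : MvPolynomial (Fin 4) K) ∈ 𝔮 := mem_of_sMul_mem_cube 𝔮 hs h
  have h1mem : (1 : MvPolynomial (Fin 4) K) ∈ 𝔮 := by
    have := Ideal.sub_mem _ hf (Ideal.mul_mem_left _ (X 1) hm)
    rwa [show (1 + X 0 * X 1 * X 2 ^ 2 * X 3 - X 1 * (X 0 * X 2 ^ 2 * X 3) : MvPolynomial (Fin 4) K) = 1 by ring] at this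
  exact one_not_mem_of_isPrime 𝔮 h1mem

/-- **P∞ is symmetric under `s ↔ w`** (so every chart-`w` / `w̃` statement is the chart-`s` / `s̃` statement with `1
↔ 3`). [elementary] [folklore] -/
theorem Pinf_symm :
    rename (Equiv.swap (1 : Fin 4) 3) (X 0 ^ 3 + X 1 * X 2 ^ 2 * X 3 : MvPolynomial (Fin 4) K) =
      X 0 ^ 3 + X 1 * X 2 ^ 2 * X 3 := by
  simp [rename_X, Equiv.swap_apply_def]; ring

/-- **THE REES-CHART SUBSTITUTION of the blow-up of a COORDINATE LINEAR CENTRE** `V(x_a : a ∈ A)`, chart `x_e` (`e ∈ A`):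
`x_a ↦ x_a·x_e (a ∈ A, a ≠ e)`, all other coordinates unchanged. DEFINITION (support; dictionary (L)). -/
def linChartSubst (A : Finset (Fin 4)) (e : Fin 4) : Fin 4 → MvPolynomial (Fin 4) K :=
  fun j => if j ∈ A ∧ j ≠ e then X j * X e else X j

/-- **P∞, STEP 2 at `s̃ = V(z, u, w)` (chart-`s` coordinates), chart `u`**: `f(z'u, s, u, w'u) = u³·(z'³ + s·w')`.
[new; elementary] [folklore] -/
theorem Pinf_L1_lineChart_X2 :
    aeval (linChartSubst (K := K) {0, 2, 3} 2) (X 0 ^ 3 + X 1 * X 2 ^ 2 * X 3 : MvPolynomial (Fin 4) K) =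
      X 2 ^ 3 * (X 0 ^ 3 + X 1 * X 3) := by
  simp [linChartSubst]; ring

/-- chart `w` of the same blow-up: `f(z'w, s, u'w, w) = w³·(z'³ + s·u'²)`. [new; elementary] [folklore] -/
theorem Pinf_L1_lineChart_X3 :
    aeval (linChartSubst (K := K) {0, 2, 3} 3) (X 0 ^ 3 + X 1 * X 2 ^ 2 * X 3 : MvPolynomial (Fin 4) K) =
      X 3 ^ 3 * (X 0 ^ 3 + X 1 * X 2 ^ 2) := by
  simp [linChartSubst]; ring

/-- chart `z` of the same blow-up: `f(z, s, u'z, w'z) = z³·(1 + s·u'²·w')`. [new; elementary] [folklore] -/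
theorem Pinf_L1_lineChart_X0 :
    aeval (linChartSubst (K := K) {0, 2, 3} 0) (X 0 ^ 3 + X 1 * X 2 ^ 2 * X 3 : MvPolynomial (Fin 4) K) =
      X 0 ^ 3 * (1 + X 1 * X 2 ^ 2 * X 3) := by
  simp [linChartSubst]; ring

/-- **P∞, STEP 2, chart `u` — NO top point**: `z'³ + s·w'` has no prime of order `≥ 3` (`∂_{w'}` gives `s²·s… `; precisely
`s_·²·s ∈ 𝔮²` for the order witness `s_`, then `∂_s`: `s_⁴ ∈ 𝔮`). [new; elementary] [folklore] -/
theorem Pinf_L1_lineChart_X2_noTop (𝔮 : Ideal (MvPolynomial (Fin 4) K)) [𝔮.IsPrime] {s : MvPolynomial (Fin 4) K} (hs : s ∉ 𝔮)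
    (h : s * (X 0 ^ 3 + X 1 * X 3 : MvPolynomial (Fin 4) K) ∈ 𝔮 ^ 3) : False := by
  have hs2 : s ^ 2 ∉ 𝔮 := pow_not_mem 𝔮 hs 2
  have hs4 : (s ^ 2) ^ 2 ∉ 𝔮 := pow_not_mem 𝔮 hs2 2
  have e30 := f_ne K (i := 3) (j := 0) (by decide)
  have e31 := f_ne K (i := 3) (j := 1) (by decide)
  have e33 := f_self K 3
  have e11 := f_self K 1
  have d3 : pderiv 3 (X 0 ^ 3 + X 1 * X 3 : MvPolynomial (Fin 4) K) = X 1 := by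
    simp only [map_add, Derivation.leibniz, Derivation.leibniz_pow, smul_eq_mul, nsmul_eq_mul, e30, e31, e33]
    push_cast; ring
  have h3 := sq_mul_deriv_mem_pow 𝔮 h (pderiv 3)
  rw [d3] at h3
  have h31 := sq_mul_deriv_mem_pow 𝔮 h3 (pderiv 1)
  rw [e11, mul_one, pow_one] at h31
  exact hs4 h31

/-- **P∞, STEP 2, chart `w` — CLASSIFICATION + TAMENESS**: every prime of order `≥ 3` for `z'³ + s·u'²` contains
`z'`, `s`, `u'` (the
strict transform of the exceptional line `ℓ`), and `∂_{u'}∂_{u'} = 2·s` with `s` a REGULAR PARAMETER there: ALL top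
points of this
chart are TAME. [new; elementary] [folklore] -/
theorem Pinf_L1_lineChart_X3_tame [CharP K 3] (𝔫 : Ideal (MvPolynomial (Fin 4) K)) [𝔫.IsPrime] {s : MvPolynomial (Fin 4) K}
    (hs : s ∉ 𝔫) (h : s * (X 0 ^ 3 + X 1 * X 2 ^ 2 : MvPolynomial (Fin 4) K) ∈ 𝔫 ^ 3) :
    ((X 0 : MvPolynomial (Fin 4) K) ∈ 𝔫 ∧ (X 1 : MvPolynomial (Fin 4) K) ∈ 𝔫 ∧ (X 2 : MvPolynomial (Fin 4) K) ∈ 𝔫) ∧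
      (pderiv 2) ((pderiv 2) (X 0 ^ 3 + X 1 * X 2 ^ 2 : MvPolynomial (Fin 4) K)) = 2 * X 1 ∧
      ∀ s' ∉ 𝔫, s' * (X 1 : MvPolynomial (Fin 4) K) ∉ 𝔫 ^ 2 := by
  have hs2 : s ^ 2 ∉ 𝔫 := pow_not_mem 𝔫 hs 2
  have hs4 : (s ^ 2) ^ 2 ∉ 𝔫 := pow_not_mem 𝔫 hs2 2
  have h2 : (2 : MvPolynomial (Fin 4) K) ∉ 𝔫 := two_not_mem (K := K) 𝔫
  have e10 := f_ne K (i := 1) (j := 0) (by decide)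
  have e12 := f_ne K (i := 1) (j := 2) (by decide)
  have e20 := f_ne K (i := 2) (j := 0) (by decide)
  have e21 := f_ne K (i := 2) (j := 1) (by decide)
  have e11 := f_self K 1
  have e22 := f_self K 2
  have d2 : pderiv 2 (X 0 ^ 3 + X 1 * X 2 ^ 2 : MvPolynomial (Fin 4) K) = 2 * (X 1 * X 2) := by
    simp only [map_add, Derivation.leibniz, Derivation.leibniz_pow, smul_eq_mul, nsmul_eq_mul, e20, e21, e22]
    push_cast; ring
  have d22 : pderiv 2 (2 * (X 1 * X 2) : MvPolynomial (Fin 4) K) = 2 * X 1 ^ 1 := by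
    simp only [Derivation.leibniz, smul_eq_mul, e21, e22, f_two]; ring
  have d1 : pderiv 1 (X 0 ^ 3 + X 1 * X 2 ^ 2 : MvPolynomial (Fin 4) K) = 1 * X 2 ^ 2 := by
    simp only [map_add, Derivation.leibniz, Derivation.leibniz_pow, smul_eq_mul, nsmul_eq_mul, e10, e11, e12]
    push_cast; ring
  have hX1 : (X 1 : MvPolynomial (Fin 4) K) ∈ 𝔫 := by
    have h' := sq_mul_deriv_mem_pow 𝔫 h (pderiv 2)
    rw [d2] at h'
    have h'' := sq_mul_deriv_mem_pow 𝔫 h' (pderiv 2)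
    rw [d22] at h''
    exact mem_of_mul_mul_pow_mem_pow 𝔫 one_ne_zero hs4 h2 h''
  have hX2 : (X 2 : MvPolynomial (Fin 4) K) ∈ 𝔫 := by
    have h' := sq_mul_deriv_mem_pow 𝔫 h (pderiv 1)
    rw [d1] at h'
    exact mem_of_mul_mul_pow_mem_pow 𝔫 two_ne_zero hs2 (one_not_mem_of_isPrime 𝔫) h'
  have hf : (X 0 ^ 3 + X 1 * X 2 ^ 2 : MvPolynomial (Fin 4) K) ∈ 𝔫 := mem_of_sMul_mem_cube 𝔫 hs h
  have hX0 : (X 0 : MvPolynomial (Fin 4) K) ∈ 𝔫 := by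
    refine ‹𝔫.IsPrime›.mem_of_pow_mem 3 ?_
    have := Ideal.sub_mem _ hf (Ideal.mul_mem_right (X 2 ^ 2) _ hX1)
    rwa [add_sub_cancel_right] at this
  have dd : (pderiv 2) ((pderiv 2) (X 0 ^ 3 + X 1 * X 2 ^ 2 : MvPolynomial (Fin 4) K)) = 2 * X 1 := by
    rw [d2, d22, pow_one]
  exact ⟨⟨hX0, hX1, hX2⟩, dd, fun s' hs' hmem => sMul_not_mem_sq_of_pderiv_eq_one 𝔫 1 hX1 e11 hs' hmem⟩

/-- **P∞, STEP 2, chart `z` — NO top point**: `1 + s·u'²·w'` has no prime of order `≥ 3` (`∂_s` gives `u'²·w' ∈ 𝔮`,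
then `1 ∈ 𝔮`).
[new; elementary] [folklore] -/
theorem Pinf_L1_lineChart_X0_noTop (𝔮 : Ideal (MvPolynomial (Fin 4) K)) [𝔮.IsPrime] {s : MvPolynomial (Fin 4) K} (hs : s ∉ 𝔮)
    (h : s * (1 + X 1 * X 2 ^ 2 * X 3 : MvPolynomial (Fin 4) K) ∈ 𝔮 ^ 3) : False := by
  have hs2 : s ^ 2 ∉ 𝔮 := pow_not_mem 𝔮 hs 2
  have e12 := f_ne K (i := 1) (j := 2) (by decide)
  have e13 := f_ne K (i := 1) (j := 3) (by decide)
  have e11 := f_self K 1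
  have d1 : pderiv 1 (1 + X 1 * X 2 ^ 2 * X 3 : MvPolynomial (Fin 4) K) = X 2 ^ 2 * X 3 := by
    simp only [map_add, Derivation.leibniz, Derivation.leibniz_pow, smul_eq_mul, nsmul_eq_mul, e11, e12, e13, f_one]
    push_cast; ring
  have h1 := sq_mul_deriv_mem_pow 𝔮 h (pderiv 1)
  rw [d1] at h1
  have hm : (X 2 ^ 2 * X 3 : MvPolynomial (Fin 4) K) ∈ 𝔮 :=
    (‹𝔮.IsPrime›.mem_or_mem (Ideal.pow_le_self two_ne_zero h1)).resolve_left hs2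
  have hf : (1 + X 1 * X 2 ^ 2 * X 3 : MvPolynomial (Fin 4) K) ∈ 𝔮 := mem_of_sMul_mem_cube 𝔮 hs h
  have h1mem : (1 : MvPolynomial (Fin 4) K) ∈ 𝔮 := by
    have := Ideal.sub_mem _ hf (Ideal.mul_mem_left _ (X 1) hm)
    rwa [show (1 + X 1 * X 2 ^ 2 * X 3 - X 1 * (X 2 ^ 2 * X 3) : MvPolynomial (Fin 4) K) = 1 by ring] at this
  exact one_not_mem_of_isPrime 𝔮 h1mem

/-- **P∞ — THE PERPETUAL CERTIFICATE (kind B INHABITED; ONE self-reproduction law valid at EVERY level).**  Read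
with the dictionary:
(T) the top locus is the union of the two axes, both genuinely lines; (W) the origin is WILD, with near points (`O_s`: `f ∈ 𝔫₀³`
trivially as `f` reproduces); (Tm) every other top point is TAME; (R) in the charts `s` and `w` of the blow-up of the origin the
transform IS `f` — so over every bad point there are EXACTLY two bad points `O_s, O_w`, each a copy of the datum:
every level of the
canonical bad run is FINITE (`2^i` points) and NONEMPTY, i.e. `RunPerpetual 3 (𝔸⁴, (P∞))` (LEMMA A `blowup_badCentre_base_mem` +
induction on the level); (U) chart `u`: the only top point is its origin and it is TAME; (Z) chart `z`: no top
point. [new] [folklore] -/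
theorem Pinf_perpetual_certificate [CharP K 3] :
    -- (T) top locus = `s`-axis ∪ `w`-axis, two lines
    (∀ (𝔮 : Ideal (MvPolynomial (Fin 4) K)) [𝔮.IsPrime], ∀ s ∉ 𝔮,
        s * (X 0 ^ 3 + X 1 * X 2 ^ 2 * X 3 : MvPolynomial (Fin 4) K) ∈ 𝔮 ^ 3 →
          (X 0 : MvPolynomial (Fin 4) K) ∈ 𝔮 ∧ (X 2 : MvPolynomial (Fin 4) K) ∈ 𝔮 ∧
            ((X 1 : MvPolynomial (Fin 4) K) ∈ 𝔮 ∨ (X 3 : MvPolynomial (Fin 4) K) ∈ 𝔮)) ∧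
      (X 0 ^ 3 + X 1 * X 2 ^ 2 * X 3 : MvPolynomial (Fin 4) K) ∈ (Ideal.span {(X 0 : MvPolynomial (Fin 4) K), X 2, X 3}) ^ 3 ∧
      (X 0 ^ 3 + X 1 * X 2 ^ 2 * X 3 : MvPolynomial (Fin 4) K) ∈ (Ideal.span {(X 0 : MvPolynomial (Fin 4) K), X 1, X 2}) ^ 3 ∧
      ((X 1 : MvPolynomial (Fin 4) K) ∉ Ideal.span {(X 0 : MvPolynomial (Fin 4) K), X 2, X 3} ∧
        (X 3 : MvPolynomial (Fin 4) K) ∉ Ideal.span {(X 0 : MvPolynomial (Fin 4) K), X 1, X 2}) ∧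
    -- (W) wild at the origin: `f = z³ + r`, `r ∈ 𝔫₀⁴`
      (X 1 * X 2 ^ 2 * X 3 : MvPolynomial (Fin 4) K) ∈ (Ideal.span {(X 0 : MvPolynomial (Fin 4) K), X 1, X 2, X 3}) ^ 4 ∧
    -- (Tm) tame along both punctured axes: `∂_u∂_u f = 2·(s·w)`, `s·w` a regular parameter
      (pderiv 2) ((pderiv 2) (X 0 ^ 3 + X 1 * X 2 ^ 2 * X 3 : MvPolynomial (Fin 4) K)) = 2 * (X 1 * X 3) ∧
      (∀ (𝔫 : Ideal (MvPolynomial (Fin 4) K)) [𝔫.IsPrime], (X 1 : MvPolynomial (Fin 4) K) ∈ 𝔫 → (X 3 : MvPolynomial (Fin 4) K) ∉ 𝔫 →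
        (X 1 * X 3 : MvPolynomial (Fin 4) K) ∈ 𝔫 ∧ ∀ s' ∉ 𝔫, s' * (X 1 * X 3 : MvPolynomial (Fin 4) K) ∉ 𝔫 ^ 2) ∧
      (∀ (𝔫 : Ideal (MvPolynomial (Fin 4) K)) [𝔫.IsPrime], (X 3 : MvPolynomial (Fin 4) K) ∈ 𝔫 → (X 1 : MvPolynomial (Fin 4) K) ∉ 𝔫 →
        (X 1 * X 3 : MvPolynomial (Fin 4) K) ∈ 𝔫 ∧ ∀ s' ∉ 𝔫, s' * (X 1 * X 3 : MvPolynomial (Fin 4) K) ∉ 𝔫 ^ 2) ∧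
    -- (R) REPRODUCTION in charts `s` and `w`; chart `u`; chart `z`
      aeval (chartSubst (K := K) 1) (X 0 ^ 3 + X 1 * X 2 ^ 2 * X 3 : MvPolynomial (Fin 4) K) =
        X 1 ^ 3 * (X 0 ^ 3 + X 1 * X 2 ^ 2 * X 3) ∧
      aeval (chartSubst (K := K) 3) (X 0 ^ 3 + X 1 * X 2 ^ 2 * X 3 : MvPolynomial (Fin 4) K) =
        X 3 ^ 3 * (X 0 ^ 3 + X 1 * X 2 ^ 2 * X 3) ∧
      aeval (chartSubst (K := K) 2) (X 0 ^ 3 + X 1 * X 2 ^ 2 * X 3 : MvPolynomial (Fin 4) K) =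
        X 2 ^ 3 * (X 0 ^ 3 + X 1 * X 2 * X 3) ∧
      aeval (chartSubst (K := K) 0) (X 0 ^ 3 + X 1 * X 2 ^ 2 * X 3 : MvPolynomial (Fin 4) K) =
        X 0 ^ 3 * (1 + X 0 * X 1 * X 2 ^ 2 * X 3) ∧
    -- (U) chart `u`: the only top point is the origin, TAME (`∂_{s'}∂_{w'} = u` a regular parameter)
      (∀ (𝔮 : Ideal (MvPolynomial (Fin 4) K)) [𝔮.IsPrime], ∀ s ∉ 𝔮,
        s * (X 0 ^ 3 + X 1 * X 2 * X 3 : MvPolynomial (Fin 4) K) ∈ 𝔮 ^ 3 →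
          ((X 0 : MvPolynomial (Fin 4) K) ∈ 𝔮 ∧ (X 1 : MvPolynomial (Fin 4) K) ∈ 𝔮 ∧ (X 2 : MvPolynomial (Fin 4) K) ∈ 𝔮 ∧
            (X 3 : MvPolynomial (Fin 4) K) ∈ 𝔮) ∧
          (pderiv 1) ((pderiv 3) (X 0 ^ 3 + X 1 * X 2 * X 3 : MvPolynomial (Fin 4) K)) = X 2 ∧
          ∀ s' ∉ Ideal.span {(X 0 : MvPolynomial (Fin 4) K), X 1, X 2, X 3},
            s' * (X 2 : MvPolynomial (Fin 4) K) ∉ (Ideal.span {(X 0 : MvPolynomial (Fin 4) K), X 1, X 2, X 3}) ^ 2) ∧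
    -- (Z) chart `z`: no top point
      (∀ (𝔮 : Ideal (MvPolynomial (Fin 4) K)) [𝔮.IsPrime], ∀ s ∉ 𝔮,
        s * (1 + X 0 * X 1 * X 2 ^ 2 * X 3 : MvPolynomial (Fin 4) K) ∈ 𝔮 ^ 3 → False) :=
  ⟨fun 𝔮 _ _ hs h => Pinf_top 𝔮 hs h, Pinf_mem_cube_sAxis, Pinf_mem_cube_wAxis, Pinf_axes_nondegenerate, Pinf_wild, Pinf_dd,
    fun 𝔫 _ h1 h3 => Pinf_tame_wAxis 𝔫 h1 h3, fun 𝔫 _ h3 h1 => Pinf_tame_sAxis 𝔫 h3 h1, Pinf_chart_s, Pinf_chart_w, Pinf_chart_u,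
    Pinf_chart_z, fun 𝔮 _ _ hs h => Pinf_chart_u_only 𝔮 hs h, fun 𝔮 _ _ hs h => Pinf_chart_z_noTop 𝔮 hs h⟩

/-- **P∞ — THE SEPARATING CERTIFICATE (g26-DECIDED at sep-height 1).**  Level 0 is ACTIVE (bad₀ = {origin}: finite
nonempty levels
are active, `sepActive_of_badFinite`); STEP 1 = the point blow-up of `Pinf_perpetual_certificate`; STEP 2: the
strict transforms of
the two punctured axes are the DISJOINT coordinate lines `s̃ = V(z', u', w') ⊆ chart s` and `w̃ ⊆ chart w` (`f ∈ 𝔮³`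
along them by
(T)/(R); regular, disjoint: dictionary (R)) — it FIRES; in the line charts (dictionary (L), chart-`s` coordinates; chart `w` by
`Pinf_symm`): chart `u`: no top point; chart `w`: every top point TAME; chart `z`: no top point; the top points of level 1 off
`s̃ ⊔ w̃` (`ℓ ∖ {O_s, O_w}`, `O_u`) are TAME by (Tm)/(U) and unchanged by step 2.  So the bad locus of sep-level 1 is EMPTY:
`SepTerminates 3 (𝔸⁴, (P∞))` with height 1 — P∞ is g25-RESIDUAL (kind B) and g26-DECIDED. [new] [folklore] -/
theorem Pinf_sepHeightOne_certificate [CharP K 3] :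
    -- step-2 centre in chart `s`: the line `V(z', u', w')` lies in the top locus and is a line
      (X 0 ^ 3 + X 1 * X 2 ^ 2 * X 3 : MvPolynomial (Fin 4) K) ∈ (Ideal.span {(X 0 : MvPolynomial (Fin 4) K), X 2, X 3}) ^ 3 ∧
      (X 1 : MvPolynomial (Fin 4) K) ∉ Ideal.span {(X 0 : MvPolynomial (Fin 4) K), X 2, X 3} ∧
    -- the three line charts (L)
      aeval (linChartSubst (K := K) {0, 2, 3} 2) (X 0 ^ 3 + X 1 * X 2 ^ 2 * X 3 : MvPolynomial (Fin 4) K) =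
        X 2 ^ 3 * (X 0 ^ 3 + X 1 * X 3) ∧
      aeval (linChartSubst (K := K) {0, 2, 3} 3) (X 0 ^ 3 + X 1 * X 2 ^ 2 * X 3 : MvPolynomial (Fin 4) K) =
        X 3 ^ 3 * (X 0 ^ 3 + X 1 * X 2 ^ 2) ∧
      aeval (linChartSubst (K := K) {0, 2, 3} 0) (X 0 ^ 3 + X 1 * X 2 ^ 2 * X 3 : MvPolynomial (Fin 4) K) =
        X 0 ^ 3 * (1 + X 1 * X 2 ^ 2 * X 3) ∧
    -- chart `u`: NO top point
      (∀ (𝔮 : Ideal (MvPolynomial (Fin 4) K)) [𝔮.IsPrime], ∀ s ∉ 𝔮,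
        s * (X 0 ^ 3 + X 1 * X 3 : MvPolynomial (Fin 4) K) ∈ 𝔮 ^ 3 → False) ∧
    -- chart `w`: every top point contains `z', s, u'` and is TAME (`∂∂ = 2·s`, `s` a regular parameter)
      (∀ (𝔫 : Ideal (MvPolynomial (Fin 4) K)) [𝔫.IsPrime], ∀ s ∉ 𝔫,
        s * (X 0 ^ 3 + X 1 * X 2 ^ 2 : MvPolynomial (Fin 4) K) ∈ 𝔫 ^ 3 →
          ((X 0 : MvPolynomial (Fin 4) K) ∈ 𝔫 ∧ (X 1 : MvPolynomial (Fin 4) K) ∈ 𝔫 ∧ (X 2 : MvPolynomial (Fin 4) K) ∈ 𝔫) ∧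
          (pderiv 2) ((pderiv 2) (X 0 ^ 3 + X 1 * X 2 ^ 2 : MvPolynomial (Fin 4) K)) = 2 * X 1 ∧
          ∀ s' ∉ 𝔫, s' * (X 1 : MvPolynomial (Fin 4) K) ∉ 𝔫 ^ 2) ∧
    -- chart `z`: NO top point
      (∀ (𝔮 : Ideal (MvPolynomial (Fin 4) K)) [𝔮.IsPrime], ∀ s ∉ 𝔮,
        s * (1 + X 1 * X 2 ^ 2 * X 3 : MvPolynomial (Fin 4) K) ∈ 𝔮 ^ 3 → False) ∧
    -- symmetry `s ↔ w` (chart `w` / `w̃`)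
      rename (Equiv.swap (1 : Fin 4) 3) (X 0 ^ 3 + X 1 * X 2 ^ 2 * X 3 : MvPolynomial (Fin 4) K) =
        X 0 ^ 3 + X 1 * X 2 ^ 2 * X 3 :=
  ⟨Pinf_mem_cube_sAxis, Pinf_axes_nondegenerate.1, Pinf_L1_lineChart_X2, Pinf_L1_lineChart_X3, Pinf_L1_lineChart_X0,
    fun 𝔮 _ _ hs h => Pinf_L1_lineChart_X2_noTop 𝔮 hs h, fun 𝔫 _ _ hs h => Pinf_L1_lineChart_X3_tame 𝔫 hs h,
    fun 𝔮 _ _ hs h => Pinf_L1_lineChart_X0_noTop 𝔮 hs h, Pinf_symm⟩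

/-- **P∞ — NEAR POINT at the germs**: `f ∈ 𝔫₀³` (at `O_s`, `O_w` the transform IS `f`, so the chart origin is a near
point of the
wild bad point below: the bad point is δ-HEAVY and is again BAD — an infinite wild δ-heavy near-point chain).
[elementary] [folklore] -/
theorem Pinf_near :
    (X 0 ^ 3 + X 1 * X 2 ^ 2 * X 3 : MvPolynomial (Fin 4) K) ∈ (Ideal.span {(X 0 : MvPolynomial (Fin 4) K), X 1, X 2, X 3}) ^ 3 := by
  refine Ideal.add_mem _ (Ideal.pow_mem_pow (X_mem_spanX4 0) 3) ?_
  exact Ideal.pow_le_pow_right (by norm_num) Pinf_wild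

end SepCertificates

end Summit.ResolutionOfSingularities.ResolutionOfSingularities.Theorems.DeltaCutClasses
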